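import Summits.BirchSwinnertonDyer.BirchSwinnertonDyer.Theorems.ThetaPartnerAtTwoSignedTransportAtTwoLocalProductCount
import HarnessLib

/-!
# `Sel♯_{S₀}` is `p`-divisible as soon as `Sel♯_∅` is and the local factors are — splitting the registered stub `stub_sharpDiv2` of line `bridge`
# v21 (crux `SignedTransportAtTwo`, stmt-BirchSwinnertonDyer-20333, route `ThetaPartnerAtTwo`) into "`X⁺(E/ℚ_∞)` has no finite `Λ`-submodule"
# (B. D. Kim 2013 / Kitajima–Otsuki 2018 READ AT `p = 2`; research) + the divisibility of GV's local factors (Prop. (2.4); in print) + the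
# surjectivity `stub_surj2` (lead prover bsd-wall-tp2-p1 g6; `--supports`; route-independent, closes nothing)

HONEST FRAMING. THEOREMS ONLY; no definition; BSD is not proved by any of this; the three inputs are HYPOTHESES. Objects as in p583281/p585511
(`Sel♯_S` spelled out; `Y_v = im(H¹(H ∩ D_v, E[p^∞]) → H¹(H ∩ I_v, E[p^∞]))`; detecting map `(r_v ∘ conj_{γⁿ})_{v ∈ S₀, n < N_v}`).

* `detect_eq_zero_iff_mem_sharp_empty` — for `c ∈ Sel♯_{S₀}`: all `r_v(conj_{γⁿ} c) = 0` (`v ∈ S₀`, `n < N_v`) iff `c ∈ Sel♯_∅` (the kernel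
  identity of p583281, exported);
* `sharp_divisible_of_surj_of_loc_of_empty` — if the detecting map is onto `∏_v ∏_{n<N_v} Y_v`, every `Y_v` (`v ∈ S₀`) is `p`-divisible and
  `Sel♯_∅` is `p`-divisible, then `Sel♯_{S₀}` is `p`-divisible ("divisible-by-divisible"; GV 2000 Prop. (2.5) p. 23 / Lemma (2.6) shape).

References: [GreenbergVatsal2000] §2 Prop. (2.1), Prop. (2.4), Prop. (2.5), Lemma (2.6); [BDKim2013] Thm. 1.1 (no finite submodules, `p` odd).
-/

set_option autoImplicit false
-- D-0017: single-problem summit, so `Summit.BirchSwinnertonDyer.BirchSwinnertonDyer.…` repeats a namespace BY DESIGN.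
set_option linter.dupNamespace false

noncomputable section

open scoped Classical AddSubgroup

open NumberField IsDedekindDomain Field CategoryTheory
open Literature.NumberTheory.GaloisRepresentations Literature.NumberTheory.EllipticCurves
  Literature.NumberTheory.EllipticCurves.GreenbergSelmer
  Literature.NumberTheory.EllipticCurves.GreenbergVatsal2000
  Literature.NumberTheory.EllipticCurves.Kobayashi2003
  Summit.BirchSwinnertonDyer.Rank1Residual.Iwasawa

namespace Summit.BirchSwinnertonDyer.BirchSwinnertonDyer.Theorems.SignedTransportAtTwo

universe u

variable {K : Type u} [Field K] [NumberField K] (W : WeierstrassCurve K)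
  {p : ℕ} [hp : Fact p.Prime] (κ : ZpExtension K p) {γ : absoluteGaloisGroup K}

/-- **The kernel identity of the detecting map** (exported form of the step inside p583281): a class `c ∈ Sel♯_{S₀}` lies in `Sel♯_∅` iff
`r_v(conj_{γⁿ} c) = 0` for all `v ∈ S₀` and `n < N_v` (`Γ_K = H·D_v·{γⁿ : n < N_v}`, `forall_conjH1_mem_unramifiedKer_of_forall_lt`).
[cite: GreenbergVatsal2000, §2 p. 20] -/
theorem detect_eq_zero_iff_mem_sharp_empty (ε : ℤˣ) (S₀ : Finset (HeightOneSpectrum (𝓞 K)))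
    (hS₀ : ∀ v ∈ S₀, ((p : ℕ) : 𝓞 K) ∉ v.asIdeal) (N : HeightOneSpectrum (𝓞 K) → ℕ)
    (hrep : ∀ v ∈ S₀, ∀ σ : absoluteGaloisGroup K, ∃ n < N v, ∃ δ ∈ decomp (K := K) v,
      ∃ h ∈ κ.kerSubgroup, σ = h * (δ * γ ^ n))
    {c : W.subgroupH1 p κ.kerSubgroup}
    (hc : c ∈ unramifiedOutside κ.kerSubgroup ↥(W.geomPrimaryTorsion p) p (↑S₀ : Set (HeightOneSpectrum (𝓞 K))) ⊓
      ⨅ (v : HeightOneSpectrum (𝓞 K)) (_ : ((p : ℕ) : 𝓞 K) ∈ v.asIdeal) (σ : absoluteGaloisGroup K),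
        (localKummerOverOfEmb W p κ.kerSubgroup (closureEmb (K := K) (v.adicCompletion K))
            (⨆ n : ℕ, signedLocalPoints κ (v.adicCompletion K) W ε n)).comap (W.conjH1 p κ.kerSubgroup σ)) :
    (∀ v ∈ S₀, ∀ n < N v, resH1Hom (inertiaInToH κ.kerSubgroup v) (AddMonoidHom.id (W.geomPrimaryTorsion p)) (fun _ _ ↦ rfl)
        (conjH1 κ.kerSubgroup (W.geomPrimaryTorsion p) (γ ^ n) c) = 0) ↔
      c ∈ unramifiedOutside κ.kerSubgroup ↥(W.geomPrimaryTorsion p) p (∅ : Set (HeightOneSpectrum (𝓞 K))) ⊓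
        ⨅ (v : HeightOneSpectrum (𝓞 K)) (_ : ((p : ℕ) : 𝓞 K) ∈ v.asIdeal) (σ : absoluteGaloisGroup K),
          (localKummerOverOfEmb W p κ.kerSubgroup (closureEmb (K := K) (v.adicCompletion K))
              (⨆ n : ℕ, signedLocalPoints κ (v.adicCompletion K) W ε n)).comap (W.conjH1 p κ.kerSubgroup σ) := by
  haveI : κ.kerSubgroup.Normal := by rw [ZpExtension.kerSubgroup]; infer_instance
  rw [mem_sharp_empty_iff W κ ε (↑S₀ : Set _)]
  constructor
  · intro h0
    refine ⟨hc, fun v hv hpv σ ↦ ?_⟩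
    exact forall_conjH1_mem_unramifiedKer_of_forall_lt κ (W.geomPrimaryTorsion p) (hrep v (Finset.mem_coe.1 hv))
      (fun n hn ↦ h0 v (Finset.mem_coe.1 hv) n hn) σ
  · rintro ⟨-, hS⟩ v hv n hn
    exact hS v (Finset.mem_coe.2 hv) (hS₀ v hv) (γ ^ n)

/-- **Divisible-by-divisible.** If the detecting map `Sel♯_{S₀} → ∏_{v∈S₀} ∏_{n<N_v} Y_v` is ONTO (`hsurj`, GV Prop. (2.1)), every local factor
`Y_v = im(H¹(H ∩ D_v, E[p^∞]) → H¹(H ∩ I_v, E[p^∞]))` (`v ∈ S₀`) is `p`-divisible (`hlocdiv`, GV Prop. (2.4): `𝓗_η` is `ℤ_p`-cofree) and `Sel♯_∅`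
is `p`-divisible (`hdiv₀`: its dual has no finite `Λ`-submodule), then `Sel♯_{S₀}` is `p`-divisible: lift a `p`-th root of the local image,
correct by the kernel `Sel♯_∅`. GV Prop. (2.5)/Lemma (2.6) shape. [cite: GreenbergVatsal2000, §2 Prop. (2.5) and Lemma (2.6) (p. 23)] -/
theorem sharp_divisible_of_surj_of_loc_of_empty (ε : ℤˣ) (S₀ : Finset (HeightOneSpectrum (𝓞 K)))
    (hS₀ : ∀ v ∈ S₀, ((p : ℕ) : 𝓞 K) ∉ v.asIdeal) (N : HeightOneSpectrum (𝓞 K) → ℕ)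
    (hrep : ∀ v ∈ S₀, ∀ σ : absoluteGaloisGroup K, ∃ n < N v, ∃ δ ∈ decomp (K := K) v,
      ∃ h ∈ κ.kerSubgroup, σ = h * (δ * γ ^ n))
    (hsurj : ∀ y : (Π i : ↥S₀, Fin (N i.1) → discreteH1 (inertiaIn κ.kerSubgroup i.1) (W.geomPrimaryTorsion p)),
      (∀ (i : ↥S₀) (n : Fin (N i.1)), y i n ∈
        (resH1Hom (subgroupInclusion (inertiaIn_le_decompIn κ.kerSubgroup i.1)) (AddMonoidHom.id (W.geomPrimaryTorsion p))
          (fun _ _ ↦ rfl)).range) →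
      ∃ c ∈ unramifiedOutside κ.kerSubgroup ↥(W.geomPrimaryTorsion p) p (↑S₀ : Set (HeightOneSpectrum (𝓞 K))) ⊓
          ⨅ (v : HeightOneSpectrum (𝓞 K)) (_ : ((p : ℕ) : 𝓞 K) ∈ v.asIdeal) (σ : absoluteGaloisGroup K),
            (localKummerOverOfEmb W p κ.kerSubgroup (closureEmb (K := K) (v.adicCompletion K))
                (⨆ n : ℕ, signedLocalPoints κ (v.adicCompletion K) W ε n)).comap (W.conjH1 p κ.kerSubgroup σ),
        ∀ (i : ↥S₀) (n : Fin (N i.1)),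
          resH1Hom (inertiaInToH κ.kerSubgroup i.1) (AddMonoidHom.id (W.geomPrimaryTorsion p)) (fun _ _ ↦ rfl)
            (conjH1 κ.kerSubgroup (W.geomPrimaryTorsion p) (γ ^ (n : ℕ)) c) = y i n)
    (hlocdiv : ∀ v ∈ S₀, ∀ y ∈ (resH1Hom (subgroupInclusion (inertiaIn_le_decompIn κ.kerSubgroup v))
        (AddMonoidHom.id (W.geomPrimaryTorsion p)) (fun _ _ ↦ rfl)).range,
      ∃ y' ∈ (resH1Hom (subgroupInclusion (inertiaIn_le_decompIn κ.kerSubgroup v))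
        (AddMonoidHom.id (W.geomPrimaryTorsion p)) (fun _ _ ↦ rfl)).range, p • y' = y)
    (hdiv₀ : ∀ s ∈ unramifiedOutside κ.kerSubgroup ↥(W.geomPrimaryTorsion p) p (∅ : Set (HeightOneSpectrum (𝓞 K))) ⊓
        ⨅ (v : HeightOneSpectrum (𝓞 K)) (_ : ((p : ℕ) : 𝓞 K) ∈ v.asIdeal) (σ : absoluteGaloisGroup K),
          (localKummerOverOfEmb W p κ.kerSubgroup (closureEmb (K := K) (v.adicCompletion K))
              (⨆ n : ℕ, signedLocalPoints κ (v.adicCompletion K) W ε n)).comap (W.conjH1 p κ.kerSubgroup σ),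
      ∃ s', s' ∈ unramifiedOutside κ.kerSubgroup ↥(W.geomPrimaryTorsion p) p (∅ : Set (HeightOneSpectrum (𝓞 K))) ⊓
        ⨅ (v : HeightOneSpectrum (𝓞 K)) (_ : ((p : ℕ) : 𝓞 K) ∈ v.asIdeal) (σ : absoluteGaloisGroup K),
          (localKummerOverOfEmb W p κ.kerSubgroup (closureEmb (K := K) (v.adicCompletion K))
              (⨆ n : ℕ, signedLocalPoints κ (v.adicCompletion K) W ε n)).comap (W.conjH1 p κ.kerSubgroup σ) ∧ p • s' = s) :
    ∀ t : ↥(unramifiedOutside κ.kerSubgroup ↥(W.geomPrimaryTorsion p) p (↑S₀ : Set (HeightOneSpectrum (𝓞 K))) ⊓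
        ⨅ (v : HeightOneSpectrum (𝓞 K)) (_ : ((p : ℕ) : 𝓞 K) ∈ v.asIdeal) (σ : absoluteGaloisGroup K),
          (localKummerOverOfEmb W p κ.kerSubgroup (closureEmb (K := K) (v.adicCompletion K))
              (⨆ n : ℕ, signedLocalPoints κ (v.adicCompletion K) W ε n)).comap (W.conjH1 p κ.kerSubgroup σ)),
      ∃ t' : ↥(unramifiedOutside κ.kerSubgroup ↥(W.geomPrimaryTorsion p) p (↑S₀ : Set (HeightOneSpectrum (𝓞 K))) ⊓
        ⨅ (v : HeightOneSpectrum (𝓞 K)) (_ : ((p : ℕ) : 𝓞 K) ∈ v.asIdeal) (σ : absoluteGaloisGroup K),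
          (localKummerOverOfEmb W p κ.kerSubgroup (closureEmb (K := K) (v.adicCompletion K))
              (⨆ n : ℕ, signedLocalPoints κ (v.adicCompletion K) W ε n)).comap (W.conjH1 p κ.kerSubgroup σ)),
        p • t' = t := by
  haveI : κ.kerSubgroup.Normal := by rw [ZpExtension.kerSubgroup]; infer_instance
  intro t
  -- the local values of `t` and their `p`-th roots in the local factors
  have hland : ∀ (i : ↥S₀) (n : Fin (N i.1)),
      resH1Hom (inertiaInToH κ.kerSubgroup i.1) (AddMonoidHom.id (W.geomPrimaryTorsion p)) (fun _ _ ↦ rfl) (conjH1 κ.kerSubgroup (W.geomPrimaryTorsion p) (γ ^ (n : ℕ)) (t : W.subgroupH1 p κ.kerSubgroup)) ∈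
        (resH1Hom (subgroupInclusion (inertiaIn_le_decompIn κ.kerSubgroup i.1)) (AddMonoidHom.id (W.geomPrimaryTorsion p)) (fun _ _ ↦ rfl)).range := by
    intro i n
    rw [resH1Hom_inertiaInToH_eq_comp W κ.kerSubgroup i.1]
    exact ⟨_, rfl⟩
  choose y' hy'mem hy' using fun (i : ↥S₀) (n : Fin (N i.1)) ↦ hlocdiv i.1 i.2 _ (hland i n)
  -- a global class with these local values
  obtain ⟨c, hc, hcy⟩ := hsurj y' hy'mem
  -- `t − p c` is killed by the detecting map, hence lies in `Sel♯_∅`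
  have hdiff : (t : W.subgroupH1 p κ.kerSubgroup) - p • c ∈
      unramifiedOutside κ.kerSubgroup ↥(W.geomPrimaryTorsion p) p (↑S₀ : Set (HeightOneSpectrum (𝓞 K))) ⊓
        ⨅ (v : HeightOneSpectrum (𝓞 K)) (_ : ((p : ℕ) : 𝓞 K) ∈ v.asIdeal) (σ : absoluteGaloisGroup K),
          (localKummerOverOfEmb W p κ.kerSubgroup (closureEmb (K := K) (v.adicCompletion K))
              (⨆ n : ℕ, signedLocalPoints κ (v.adicCompletion K) W ε n)).comap (W.conjH1 p κ.kerSubgroup σ) :=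
    sub_mem t.2 (AddSubgroup.nsmul_mem _ hc p)
  have hzero : ∀ v ∈ S₀, ∀ n < N v, resH1Hom (inertiaInToH κ.kerSubgroup v) (AddMonoidHom.id (W.geomPrimaryTorsion p)) (fun _ _ ↦ rfl)
      (conjH1 κ.kerSubgroup (W.geomPrimaryTorsion p) (γ ^ n) ((t : W.subgroupH1 p κ.kerSubgroup) - p • c)) = 0 := by
    intro v hv n hn
    have h := hcy ⟨v, hv⟩ ⟨n, hn⟩
    have h' := hy' ⟨v, hv⟩ ⟨n, hn⟩
    rw [map_sub, map_sub, map_nsmul, map_nsmul, h, h', sub_self]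
  have hmem₀ := (detect_eq_zero_iff_mem_sharp_empty W κ ε S₀ hS₀ N hrep hdiff).1 hzero
  obtain ⟨s', hs'mem, hs'⟩ := hdiv₀ _ hmem₀
  -- `Sel♯_∅ ≤ Sel♯_{S₀}`
  have hs'SS : s' ∈ unramifiedOutside κ.kerSubgroup ↥(W.geomPrimaryTorsion p) p (↑S₀ : Set (HeightOneSpectrum (𝓞 K))) ⊓
      ⨅ (v : HeightOneSpectrum (𝓞 K)) (_ : ((p : ℕ) : 𝓞 K) ∈ v.asIdeal) (σ : absoluteGaloisGroup K),
        (localKummerOverOfEmb W p κ.kerSubgroup (closureEmb (K := K) (v.adicCompletion K))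
            (⨆ n : ℕ, signedLocalPoints κ (v.adicCompletion K) W ε n)).comap (W.conjH1 p κ.kerSubgroup σ) := by
    rw [AddSubgroup.mem_inf] at hs'mem ⊢
    refine ⟨?_, hs'mem.2⟩
    have hU := hs'mem.1
    rw [mem_unramifiedOutside_iff] at hU ⊢
    exact fun v _ hpv σ ↦ hU v (Set.notMem_empty v) hpv σ
  have hfinal : p • (c + s') = (t : W.subgroupH1 p κ.kerSubgroup) := by
    rw [smul_add, hs', add_sub_cancel]
  exact ⟨⟨c + s', add_mem hc hs'SS⟩, Subtype.ext (by rw [AddSubmonoidClass.coe_nsmul]; exact hfinal)⟩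

end Summit.BirchSwinnertonDyer.BirchSwinnertonDyer.Theorems.SignedTransportAtTwo

end
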